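import Summits.MatrixMultiplication.OmegaCensus.SmallFormats.MatMul22nRankGF7PatternList
import HarnessLib

/-!
# ω-census family (a): normalised slack-4 pattern search, subtrees part 3 of 5 (kernel replay)

Cell `pub-omega` (unit `pub-omega-tensor-g15`), topic `Summits/MatrixMultiplication/OmegaCensus` (sub-folder `SmallFormats`).
Framing (verbatim): lottery ticket; floor = certified bounds/negative ranges. HONEST FRAMING: machine-generated data / kernel replays
(`pub-omega-tensor-g15/code/gen_patternparts.py`) for step P1 of `pub-omega-tensor-g15/KERNEL-S4-DESIGN.md`; nothing here is progress on `ω`.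
Each theorem: the memory-bounded search `dfs7m 4 normMem7` succeeds from the listed depth-9 states
(27937 search nodes in this file).
-/

namespace Summit.MatrixMultiplication.OmegaCensus.SmallFormats

/-- Depth-9 states, part 3.1 (5561 nodes). -/
def G7_3_1 : List ℕ := [1622598958011219580792172306596164, 1622598958011219580792172306628932, 1622598958011219580792172306661700, 1622597720075902661894767052685508, 1622597720075902661894767052718276, 1622597720075902661894767052751044, 1622597720075902661894767052685572]

set_option maxRecDepth 100000 in
set_option maxHeartbeats 40000000 in
/-- The search succeeds from the states `G7_3_1`. -/
theorem G7_3_1_ok : (G7_3_1.all fun A => dfs7m 4 normMem7 42 9 A) = true := by decide +kernel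

/-- Depth-9 states, part 3.2 (5734 nodes). -/
def G7_3_2 : List ℕ := [1622597720075902661894767052718340, 1622597720075902661894767052751108, 1622597720075902661894767052685636, 1622597720075902661894767052718404, 1622597720075902661894767052751172, 1298080404357515220491885931233476, 1298080404357515220491885931266244, 1298080404357515220491885931299012]

set_option maxRecDepth 100000 in
set_option maxHeartbeats 40000000 in
/-- The search succeeds from the states `G7_3_2`. -/
theorem G7_3_2_ok : (G7_3_2.all fun A => dfs7m 4 normMem7 42 9 A) = true := by decide +kernel

/-- Depth-9 states, part 3.3 (5574 nodes). -/
def G7_3_3 : List ℕ := [1298080404357515220491885931233540, 1298080404357515220491885931266308, 1298080404357515220491885931299076]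

set_option maxRecDepth 100000 in
set_option maxHeartbeats 40000000 in
/-- The search succeeds from the states `G7_3_3`. -/
theorem G7_3_3_ok : (G7_3_3.all fun A => dfs7m 4 normMem7 42 9 A) = true := by decide +kernel

/-- Depth-9 states, part 3.4 (5677 nodes). -/
def G7_3_4 : List ℕ := [1298080404357515220491885931233604, 1298080404357515220491885931266372, 1298080404357515220491885931299140, 1622598958015941947275041951285445, 1622598958015941947275041951318213, 1622598958015941947275041951350981]

set_option maxRecDepth 100000 in
set_option maxHeartbeats 40000000 in
/-- The search succeeds from the states `G7_3_4`. -/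
theorem G7_3_4_ok : (G7_3_4.all fun A => dfs7m 4 normMem7 42 9 A) = true := by decide +kernel

/-- Depth-9 states, part 3.5 (5391 nodes). -/
def G7_3_5 : List ℕ := [1622598958015941947275041951285509, 1622598958015941947275041951318277, 1622598958015941947275041951351045, 1622598958015941947275041951285573, 1622598958015941947275041951318341, 1622598958015941947275041951351109, 1622598958015941947274973232070853, 1622598958015941947274973232103621, 1622598958015941947274973232136389, 1622598958015941947274973232070917, 1622598958015941947274973232103685, 1622598958015941947274973232136453, 1622598958015941947274973232070981]

set_option maxRecDepth 100000 in
set_option maxHeartbeats 40000000 in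
/-- The search succeeds from the states `G7_3_5`. -/
theorem G7_3_5_ok : (G7_3_5.all fun A => dfs7m 4 normMem7 42 9 A) = true := by decide +kernel

/-- All states of part 3. -/
def G7_3 : List ℕ := G7_3_1 ++ G7_3_2 ++ G7_3_3 ++ G7_3_4 ++ G7_3_5

/-- The search succeeds from every state of part 3. -/
theorem G7_3_ok : (G7_3.all fun A => dfs7m 4 normMem7 42 9 A) = true := by
  simp only [G7_3, List.all_append, G7_3_1_ok, G7_3_2_ok, G7_3_3_ok, G7_3_4_ok, G7_3_5_ok, Bool.and_self]

end Summit.MatrixMultiplication.OmegaCensus.SmallFormats
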